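import Summits.BirchSwinnertonDyer.BirchSwinnertonDyer.Theorems.GenusKolyvaginAtTwoPowDvdShaCardAtTwoRTSelmerLadder
import HarnessLib

/-!
# Route `GenusKolyvaginAtTwo`, crux L_T `PowDvdShaCardAtTwoRT` (stmt-BirchSwinnertonDyer-23242), LINE 18/19 stub 3a⁗ —
# TOOLBOX, steps (c)+(d) in Selmer currency for a side of POSITIVE RANK: the ladder modulo the Kummer image

Seat `bsd-line-gk2-p2` g15, `--supports 23242 --as helper`; sequel of `…RTSelmerLadder` (whose §1–§5 assume `E(K)` `p^M`-divisible,
i.e. the rank-zero side). THEOREMS ONLY. BSD is not proved by any of this.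

On the EVEN-depth side of LINE 18 the classes descend to the twin `Wd = E^{(d_K)}` of rank ONE, so `Sel^{(p^M)}(Wd/ℚ) → Ш(Wd/ℚ)[p^M]`
has kernel the Kummer image `κ(Wd(ℚ)/p^M)` (cyclic, one generator on the habitat). McCallum's ladder class must then avoid, besides the
previously peeled planes, the Kummer line — one more generator (gk2-p3 g18 `avoiding_map_of_avoiding_ker`, abstract form). Here, in the
currency of `…RTSelmerLadder`:

* §1 `exists_addMonoidHom_selmerGroup_primaryComponent_sha_surjective` — for `p^M • Ш(E/K)[p^∞] = 0`, the map
  `Sel^{(p^M)}(E/K) → Ш(E/K)[p^∞]` induced by `H¹(K,E[p^M]) → H¹(K,E)` is ONTO (Silverman X.4.2(a)), no divisibility needed.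
* §2 `pow_dvd_natCard_primaryComponent_sha_of_selmer_avoidance_mod` — THE LADDER MODULO A KERNEL-GENERATING SET `g ⊆ Sel`
  (`x ∈ Sel`, `x ↦ 0` in `H¹(K,E)` ⟹ `x ∈ ⟨g⟩`; by Kummer exactness `g` = Kummer classes of generators of `E(K)/p^M`): if for each
  `j < k` every `s ⊆ Sel` with `#s ≤ 2j` admits a Selmer class `z` with `p^{a_j} ∣ ord z` avoiding `⟨s ∪ g⟩`, then
  `p^{2 Σ a_j} ∣ #Ш(E/K)[p^∞]`.
* §3 `pow_dvd_natCard_primaryComponent_sha_of_relaxed_selmer_supply_mod` — the same from a RELAXED supply `z ∈ R`,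
  `0 < [R : Sel ∩ R] ≤ h`, with avoidance budget `2j + #g + (h − 1)` (pigeonhole repair `exists_sub_strict_of_relaxed_supply`).

References: [McCallumLMS1991] §5 Prop. 5.2, p. 310 (the subgroup `C` contains `c_{M₀+N₁}(1)`, the Heegner class);
[SilvermanAEC2009] X.4.2.
-/

noncomputable section

-- `Summit.<P>.<Sub>` repeats `BirchSwinnertonDyer` by the tree's layout convention (D-0017)
set_option linter.dupNamespace false

open scoped Classical

namespace Summit.BirchSwinnertonDyer.BirchSwinnertonDyer.Theorems.GenusExact.PlusDescent

open _root_.WeierstrassCurve AddSubgroup NumberField Literature.NumberTheory.EllipticCurves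
open Literature.GroupTheory.FiniteAbelian
open Summit.BirchSwinnertonDyer.BirchSwinnertonDyer.Theorems.GenusExact.CasselsTateNumberField

variable {K : Type} [Field K] [NumberField K] (V : WeierstrassCurve K) [V.IsElliptic] (p : ℕ) [hp : Fact p.Prime]

/-! ## §1 `Sel^{(p^M)}(E/K) ↠ Ш(E/K)[p^∞]` -/

omit [V.IsElliptic] in
/-- **`Sel^{(p^M)}(E/K) → Ш(E/K)[p^∞]` is onto when `p^M • Ш(E/K)[p^∞] = 0`** (Silverman X.4.2(a): the image of the Selmer group in
`H¹(K, E)` is `Ш[p^M] ⊇ Ш[p^∞]`), compatibly with `H¹(K,E[p^M]) → H¹(K,E)`. [cite: SilvermanAEC2009, Thm. X.4.2(a)] -/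
theorem exists_addMonoidHom_selmerGroup_primaryComponent_sha_surjective (M : ℕ)
    (hexp : ∀ y : AddCommGroup.primaryComponent V.sha p, p ^ M • y = 0) :
    ∃ f : selmerGroup V ((p ^ M : ℕ) : ℤ) →+ AddCommGroup.primaryComponent V.sha p,
      Function.Surjective f ∧
      ∀ x, (((f x : AddCommGroup.primaryComponent V.sha p) : V.sha) : V.galH1) = torsionH1ToH1 V ((p ^ M : ℕ) : ℤ) x := by
  set n : ℤ := ((p ^ M : ℕ) : ℤ) with hn_def
  have hn : n ≠ 0 := by rw [hn_def]; exact_mod_cast pow_ne_zero M hp.out.ne_zero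
  have hmap : (selmerGroup V n).map (torsionH1ToH1 V n) = V.sha ⊓ AddSubgroup.torsionBy V.galH1 n :=
    WeierstrassCurve.map_torsionH1ToH1_selmerGroup_holds V hn
  have hsha : ∀ x : selmerGroup V n, torsionH1ToH1 V n x ∈ V.sha := fun x ↦
    torsionH1ToH1_mem_sha_of_mem_selmerGroup V hn x.2
  have htor : ∀ x : selmerGroup V n, n • torsionH1ToH1 V n x = 0 := fun x ↦ by
    have hx : torsionH1ToH1 V n x ∈ (selmerGroup V n).map (torsionH1ToH1 V n) :=
      AddSubgroup.mem_map_of_mem _ x.2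
    rw [hmap] at hx
    exact mem_torsionBy_iff.mp hx.2
  have hpc : ∀ x : selmerGroup V n,
      (⟨torsionH1ToH1 V n x, hsha x⟩ : V.sha) ∈ AddCommGroup.primaryComponent V.sha p := fun x ↦ by
    refine AddCommGroup.mem_primaryComponent.mpr ⟨M, Subtype.ext ?_⟩
    rw [AddSubgroupClass.coe_nsmul, ZeroMemClass.coe_zero, ← natCast_zsmul]
    exact htor x
  let f : selmerGroup V n →+ AddCommGroup.primaryComponent V.sha p :=
    { toFun := fun x ↦ ⟨⟨torsionH1ToH1 V n x, hsha x⟩, hpc x⟩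
      map_zero' := by ext; simp
      map_add' := fun x y ↦ by ext; simp }
  have hf : ∀ x, (((f x : AddCommGroup.primaryComponent V.sha p) : V.sha) : V.galH1) = torsionH1ToH1 V n x :=
    fun _ ↦ rfl
  refine ⟨f, fun y ↦ ?_, hf⟩
  have hy : ((y : V.sha) : V.galH1) ∈ V.sha ⊓ AddSubgroup.torsionBy V.galH1 n := by
    refine ⟨(y : V.sha).2, mem_torsionBy_iff.mpr ?_⟩
    have h1 : (p ^ M) • ((y : V.sha) : V.galH1) =
        (((p ^ M • y : AddCommGroup.primaryComponent V.sha p) : V.sha) : V.galH1) := by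
      simp only [AddSubgroupClass.coe_nsmul]
    rw [hn_def, natCast_zsmul, h1, hexp y]
    rfl
  rw [← hmap] at hy
  obtain ⟨x, hx, hxy⟩ := AddSubgroup.mem_map.mp hy
  refine ⟨⟨x, hx⟩, Subtype.ext (Subtype.ext ?_)⟩
  rw [hf]
  exact hxy

/-! ## §2 The ladder modulo the Kummer image -/

/-- **The avoidance ladder in `Ш(E/K)[p^∞]` from a Selmer-currency supply that also avoids the KUMMER kernel** (positive rank
allowed). Data: `p^M • Ш(E/K)[p^∞] = 0`, `Ш[p^∞]` finite, a finite set `g ⊆ Sel^{(p^M)}(E/K)` generating the kernel of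
`Sel → H¹(K, E)` inside `Sel` (`x ∈ Sel`, `x ↦ 0` ⟹ `x ∈ ⟨g⟩` — the Kummer classes of generators of `E(K)/p^M`). If for each `j < k`
every `s ⊆ Sel` with `#s ≤ 2j` admits `z ∈ Sel` with `p^{a_j} ∣ ord z` and `⟨z⟩ ∩ ⟨s ∪ g⟩ = 0`, then `p^{2 Σ a_j} ∣ #Ш(E/K)[p^∞]`:
the image of `z` in `Ш[p^∞]` keeps its order (it avoids the kernel) and avoids the image planes.
[cite: McCallumLMS1991, §5 Prop. 5.2 and p. 310] -/
theorem pow_dvd_natCard_primaryComponent_sha_of_selmer_avoidance_mod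
    [Finite (AddCommGroup.primaryComponent V.sha p)] (M : ℕ)
    (hexp : ∀ y : AddCommGroup.primaryComponent V.sha p, p ^ M • y = 0)
    (g : Finset (galH1Torsion V ((p ^ M : ℕ) : ℤ)))
    (hker : ∀ x ∈ selmerGroup V ((p ^ M : ℕ) : ℤ), torsionH1ToH1 V ((p ^ M : ℕ) : ℤ) x = 0 →
      x ∈ AddSubgroup.closure (g : Set (galH1Torsion V ((p ^ M : ℕ) : ℤ))))
    (k : ℕ) (a : ℕ → ℕ)
    (havoid : ∀ j < k, ∀ s : Finset (galH1Torsion V ((p ^ M : ℕ) : ℤ)),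
      (↑s : Set (galH1Torsion V ((p ^ M : ℕ) : ℤ))) ⊆ selmerGroup V ((p ^ M : ℕ) : ℤ) → s.card ≤ 2 * j →
      ∃ z ∈ selmerGroup V ((p ^ M : ℕ) : ℤ), p ^ a j ∣ addOrderOf z ∧
        Disjoint (zmultiples z)
          (AddSubgroup.closure (↑(s ∪ g) : Set (galH1Torsion V ((p ^ M : ℕ) : ℤ))))) :
    p ^ (2 * ∑ j ∈ Finset.range k, a j) ∣ Nat.card (AddCommGroup.primaryComponent V.sha p) := by
  classical
  obtain ⟨f, hfsurj, hf⟩ := exists_addMonoidHom_selmerGroup_primaryComponent_sha_surjective V p M hexp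
  -- the kernel of `f` lies in `⟨g⟩`
  have hfker : ∀ y : selmerGroup V ((p ^ M : ℕ) : ℤ), f y = 0 →
      (y : galH1Torsion V ((p ^ M : ℕ) : ℤ)) ∈ AddSubgroup.closure (g : Set (galH1Torsion V ((p ^ M : ℕ) : ℤ))) := by
    intro y hy
    refine hker y y.2 ?_
    rw [← hf y, hy]; rfl
  -- a section of `f`
  have hσf : ∀ t, f (Function.surjInv hfsurj t) = t := Function.surjInv_eq hfsurj
  refine pow_dvd_natCard_primaryComponent_sha_of_avoidance V p k a fun j hj sT hcard ↦ ?_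
  -- lift `sT` to `s ⊆ Sel`
  obtain ⟨z, hzSel, hdvd, hdisj⟩ := havoid j hj
    (sT.image fun t ↦ ((Function.surjInv hfsurj t : selmerGroup V ((p ^ M : ℕ) : ℤ)) :
      galH1Torsion V ((p ^ M : ℕ) : ℤ)))
    (by
      rw [Finset.coe_image]
      rintro _ ⟨t, -, rfl⟩
      exact (Function.surjInv hfsurj t).2)
    (Finset.card_image_le.trans hcard)
  -- multiples of `z` in the kernel vanish
  have hmul_mem : ∀ c : ℤ, f (c • ⟨z, hzSel⟩) = 0 → c • z = 0 := by
    intro c hc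
    have h1 : c • z ∈ AddSubgroup.closure (g : Set (galH1Torsion V ((p ^ M : ℕ) : ℤ))) := hfker (c • ⟨z, hzSel⟩) hc
    refine (AddSubgroup.disjoint_def.mp hdisj) (zsmul_mem_zmultiples z c) (AddSubgroup.closure_mono ?_ h1)
    rw [Finset.coe_union]
    exact Set.subset_union_right
  refine ⟨f ⟨z, hzSel⟩, ?_, ?_⟩
  · -- `ord (f z) = ord z`
    have hord : addOrderOf (f ⟨z, hzSel⟩) = addOrderOf z := by
      refine Nat.dvd_antisymm ?_ ?_
      · have h := addOrderOf_map_dvd f ⟨z, hzSel⟩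
        have hmk : addOrderOf (⟨z, hzSel⟩ : selmerGroup V ((p ^ M : ℕ) : ℤ)) = addOrderOf z := addOrderOf_mk z hzSel
        rwa [hmk] at h
      · rw [addOrderOf_dvd_iff_nsmul_eq_zero]
        have h0 : f ((addOrderOf (f ⟨z, hzSel⟩) : ℤ) • ⟨z, hzSel⟩) = 0 := by
          rw [map_zsmul, natCast_zsmul, addOrderOf_nsmul_eq_zero]
        have h1 := hmul_mem _ h0
        rwa [natCast_zsmul] at h1
    rw [hord]; exact hdvd
  · -- avoidance of `⟨sT⟩`
    rw [AddSubgroup.disjoint_def]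
    intro w hw hwT
    rw [AddSubgroup.mem_zmultiples_iff] at hw
    obtain ⟨c, rfl⟩ := hw
    -- `⟨sT⟩ = f(⟨σ sT⟩)`
    have hTimage : AddSubgroup.closure (↑sT : Set (AddCommGroup.primaryComponent V.sha p)) =
        (AddSubgroup.closure (↑(sT.image (Function.surjInv hfsurj)) :
          Set (selmerGroup V ((p ^ M : ℕ) : ℤ)))).map f := by
      rw [AddMonoidHom.map_closure, Finset.coe_image, ← Set.image_comp]
      congr 1
      ext t
      simp only [Set.mem_image, Function.comp_apply, hσf, exists_eq_right, Finset.mem_coe]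
    rw [hTimage] at hwT
    obtain ⟨u, hu, hfu⟩ := AddSubgroup.mem_map.mp hwT
    -- `f (c • z - u) = 0`, so `c • z - u ∈ ⟨g⟩`, so `c • z ∈ ⟨s ∪ g⟩`, so `c • z = 0`
    have h0 : f (c • ⟨z, hzSel⟩ - u) = 0 := by rw [map_sub, map_zsmul, hfu, sub_self]
    have hug := hfker _ h0
    have hus : ((u : selmerGroup V ((p ^ M : ℕ) : ℤ)) : galH1Torsion V ((p ^ M : ℕ) : ℤ)) ∈
        AddSubgroup.closure (↑(sT.image fun t ↦
          ((Function.surjInv hfsurj t : selmerGroup V ((p ^ M : ℕ) : ℤ)) : galH1Torsion V ((p ^ M : ℕ) : ℤ))) :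
          Set (galH1Torsion V ((p ^ M : ℕ) : ℤ))) := by
      have hmap : (AddSubgroup.closure (↑(sT.image (Function.surjInv hfsurj)) :
          Set (selmerGroup V ((p ^ M : ℕ) : ℤ)))).map (selmerGroup V ((p ^ M : ℕ) : ℤ)).subtype =
          AddSubgroup.closure (↑(sT.image fun t ↦
            ((Function.surjInv hfsurj t : selmerGroup V ((p ^ M : ℕ) : ℤ)) : galH1Torsion V ((p ^ M : ℕ) : ℤ))) :
            Set (galH1Torsion V ((p ^ M : ℕ) : ℤ))) := by
        rw [AddMonoidHom.map_closure, Finset.coe_image, Finset.coe_image, ← Set.image_comp]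
        rfl
      rw [← hmap]
      exact AddSubgroup.mem_map_of_mem _ hu
    have hcz : c • z ∈ AddSubgroup.closure (↑((sT.image fun t ↦
          ((Function.surjInv hfsurj t : selmerGroup V ((p ^ M : ℕ) : ℤ)) : galH1Torsion V ((p ^ M : ℕ) : ℤ))) ∪ g) :
          Set (galH1Torsion V ((p ^ M : ℕ) : ℤ))) := by
      have heq : c • z = ((u : selmerGroup V ((p ^ M : ℕ) : ℤ)) : galH1Torsion V ((p ^ M : ℕ) : ℤ)) +
          ((c • ⟨z, hzSel⟩ - u : selmerGroup V ((p ^ M : ℕ) : ℤ)) : galH1Torsion V ((p ^ M : ℕ) : ℤ)) := by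
        rw [AddSubgroupClass.coe_sub, AddSubgroupClass.coe_zsmul, add_sub_cancel]
      rw [heq, Finset.coe_union, AddSubgroup.closure_union]
      exact AddSubgroup.add_mem _ (AddSubgroup.mem_sup_left hus) (AddSubgroup.mem_sup_right hug)
    have hcz0 : c • z = 0 := (AddSubgroup.disjoint_def.mp hdisj) (zsmul_mem_zmultiples z c) hcz
    have hczS : c • (⟨z, hzSel⟩ : selmerGroup V ((p ^ M : ℕ) : ℤ)) = 0 :=
      Subtype.ext (by rw [AddSubgroupClass.coe_zsmul, ZeroMemClass.coe_zero]; exact hcz0)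
    rw [← map_zsmul, hczS, map_zero]

/-! ## §3 (append) The same from a RELAXED supply, the index as budget -/

/-- **Positive-rank side, loss-free ladder from a RELAXED supply modulo the Kummer kernel.** `p^M • Ш(E/K)[p^∞] = 0`, `Ш[p^∞]` finite,
`g ⊆ Sel^{(p^M)}(E/K)` generating the kernel of `Sel → H¹(K, E)`, `R ≤ H¹(K, E[p^M])` with `0 < [R : Sel ∩ R] ≤ h` (the relaxed classes).
If for each `j < k` every finite `s ⊆ H¹(K,E[p^M])` with `#s ≤ 2j + #g + (h − 1)` is avoided by some `z ∈ R` with `p^{a_j} ∣ ord z`, then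
`p^{2 Σ a_j} ∣ #Ш(E/K)[p^∞]` (pigeonhole repair `exists_sub_strict_of_relaxed_supply` with `π : H¹ → H¹/Sel`, then §2). On the LINE 18
even side (`Wd` of rank one, `#Wd(ℚ)_tors` odd): `#g = 1`. [cite: McCallumLMS1991, §5 Prop. 5.2 and p. 310] -/
theorem pow_dvd_natCard_primaryComponent_sha_of_relaxed_selmer_supply_mod
    [Finite (AddCommGroup.primaryComponent V.sha p)] (M : ℕ)
    (hexp : ∀ y : AddCommGroup.primaryComponent V.sha p, p ^ M • y = 0)
    (g : Finset (galH1Torsion V ((p ^ M : ℕ) : ℤ)))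
    (hker : ∀ x ∈ selmerGroup V ((p ^ M : ℕ) : ℤ), torsionH1ToH1 V ((p ^ M : ℕ) : ℤ) x = 0 →
      x ∈ AddSubgroup.closure (g : Set (galH1Torsion V ((p ^ M : ℕ) : ℤ))))
    (R : AddSubgroup (galH1Torsion V ((p ^ M : ℕ) : ℤ))) {h : ℕ}
    (hidx : (selmerGroup V ((p ^ M : ℕ) : ℤ)).relIndex R ≤ h)
    (hidx0 : (selmerGroup V ((p ^ M : ℕ) : ℤ)).relIndex R ≠ 0) (k : ℕ) (a : ℕ → ℕ)
    (hsupply : ∀ j < k, ∀ s : Finset (galH1Torsion V ((p ^ M : ℕ) : ℤ)), s.card ≤ 2 * j + g.card + (h - 1) →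
      ∃ z ∈ R, p ^ a j ∣ addOrderOf z ∧
        Disjoint (zmultiples z) (AddSubgroup.closure (s : Set (galH1Torsion V ((p ^ M : ℕ) : ℤ))))) :
    p ^ (2 * ∑ j ∈ Finset.range k, a j) ∣ Nat.card (AddCommGroup.primaryComponent V.sha p) := by
  classical
  -- the defect set `F = R/Sel`
  have hcardI : Nat.card ((R.map (QuotientAddGroup.mk' (selmerGroup V ((p ^ M : ℕ) : ℤ))))) =
      (selmerGroup V ((p ^ M : ℕ) : ℤ)).relIndex R := natCard_map_mk'_eq_relIndex _ R
  haveI hfinI : Finite (R.map (QuotientAddGroup.mk' (selmerGroup V ((p ^ M : ℕ) : ℤ)))) :=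
    Nat.finite_of_card_ne_zero (hcardI ▸ hidx0)
  have hIfin : ((R.map (QuotientAddGroup.mk' (selmerGroup V ((p ^ M : ℕ) : ℤ))) : AddSubgroup _) :
      Set (galH1Torsion V ((p ^ M : ℕ) : ℤ) ⧸ selmerGroup V ((p ^ M : ℕ) : ℤ))).Finite := Set.toFinite _
  have hmemF : ∀ z ∈ R, QuotientAddGroup.mk' (selmerGroup V ((p ^ M : ℕ) : ℤ)) z ∈ hIfin.toFinset := fun z hz ↦ by
    rw [Set.Finite.mem_toFinset]
    exact AddSubgroup.mem_map_of_mem _ hz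
  have hFcard : hIfin.toFinset.card = (selmerGroup V ((p ^ M : ℕ) : ℤ)).relIndex R := by
    rw [← hcardI]
    exact (Nat.card_eq_card_finite_toFinset hIfin).symm
  have h0F : (0 : galH1Torsion V ((p ^ M : ℕ) : ℤ) ⧸ selmerGroup V ((p ^ M : ℕ) : ℤ)) ∈ hIfin.toFinset := by
    rw [← map_zero (QuotientAddGroup.mk' (selmerGroup V ((p ^ M : ℕ) : ℤ)))]; exact hmemF 0 R.zero_mem
  have hFerase : (hIfin.toFinset.erase 0).card ≤ h - 1 := by
    rw [Finset.card_erase_of_mem h0F, hFcard]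
    exact Nat.sub_le_sub_right hidx 1
  refine pow_dvd_natCard_primaryComponent_sha_of_selmer_avoidance_mod V p M hexp g hker k a fun j hj s _ hcard ↦ ?_
  have hsup' : ∀ s' : Finset (galH1Torsion V ((p ^ M : ℕ) : ℤ)), s'.card ≤ 2 * j + g.card + (hIfin.toFinset.erase 0).card →
      ∃ z ∈ R, p ^ a j ∣ addOrderOf z ∧ QuotientAddGroup.mk' (selmerGroup V ((p ^ M : ℕ) : ℤ)) z ∈ hIfin.toFinset ∧
        Disjoint (zmultiples z) (AddSubgroup.closure (s' : Set (galH1Torsion V ((p ^ M : ℕ) : ℤ)))) := by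
    intro s' hs'
    obtain ⟨z, hzR, hdvd, hdisj⟩ := hsupply j hj s' (by omega)
    exact ⟨z, hzR, hdvd, hmemF z hzR, hdisj⟩
  have hsg : (s ∪ g).card ≤ 2 * j + g.card := (Finset.card_union_le s g).trans (by omega)
  obtain ⟨z, -, hdvd, hπz, hdisj⟩ := exists_sub_strict_of_relaxed_supply R
    (QuotientAddGroup.mk' (selmerGroup V ((p ^ M : ℕ) : ℤ))) hIfin.toFinset (p ^ a j)
    (2 * j + g.card + (hIfin.toFinset.erase 0).card) hsup' (s ∪ g) (by omega)
  refine ⟨z, ?_, hdvd, hdisj⟩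
  rw [QuotientAddGroup.mk'_apply, QuotientAddGroup.eq_zero_iff] at hπz
  exact hπz

end Summit.BirchSwinnertonDyer.BirchSwinnertonDyer.Theorems.GenusExact.PlusDescent

end
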